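import Summits.PneNP.PneNP.Theses.Learning
import Summits.PneNP.PneNP.Theorems.LearningAssembly
import Literature.Computability.Complexity.ClayProblemProofs
import Literature.Computability.Complexity.NondeterministicProofs

/-!
# Route Learning — `Assembly`, rev 3 (stmt-PneNP-10728)

`Assembly := LearningOccam → LearningThesis → PneNP`: if `P = NP` makes every `SIZE[n^k]` polynomially PAC-predictable (Occam)
and some `SIZE[n^k]` is not (the thesis), then Cook's `P ≠ NP`. The honest-form assembly
`Literature.Learning.learning_assembly` (Theorems/LearningAssembly.lean, stmt-PneNP-0415) takes the three model bridges
`P_bool_eq`, `NP_bool_eq`, `P_subset_NP` as hypotheses; here they are discharged by the proved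
`P_bool_eq_holds`, `NP_bool_eq_holds`, `P_subset_NP_holds`.
-/

set_option linter.dupNamespace false -- `Summit.PneNP.PneNP.…`: summit = sub-problem name (D-0017 single-conjunct layout)

namespace Summit.PneNP.PneNP.Theorems

/-- **Assembly item of route Learning, rev 3 (stmt-PneNP-10728)**: `LearningOccam → LearningThesis → PneNP`, by
`Literature.Learning.learning_assembly` with the model bridges discharged (`P_bool_eq_holds`, `NP_bool_eq_holds`,
`P_subset_NP_holds`). [cite: BlumerEhrenfeuchtHausslerWarmuth1989, Thm 2.1] [folklore] -/
theorem learning_assembly_rev3_proof : Summit.PneNP.PneNP.Theses.Learning.Assembly := by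
  unfold Summit.PneNP.PneNP.Theses.Learning.Assembly Summit.PneNP.PneNP.Theses.Learning.LearningOccam
    Summit.PneNP.PneNP.Theses.Learning.LearningThesis
  exact Literature.Learning.learning_assembly Literature.Computability.Complexity.P_bool_eq_holds
    Literature.Computability.Complexity.NP_bool_eq_holds Literature.Computability.Complexity.P_subset_NP_holds

end Summit.PneNP.PneNP.Theorems
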